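import Summits.ValiantsHypothesis.ValiantsHypothesis.Theorems.SymPencilPerFourInnerRankPureReduction

/-!
# Route `SymPencil` — inner rank of the `2 | 2` row split of `per_4`: the REDUCED FAMILY with all
# its data (`--supports` stmt-ValiantsHypothesis-5674 `SdcSuperquadratic`; (8,8) column; memo
# `NOTE-p6g15-5674-IR12-reduction.md` §11 — the form in which the successor should attack P1 ∪ R2)

**Theorem** (`exists_reduced_family`).  From any solution of
`Σ_r c_r t_r((a,b),(y₂,y₃))² = per (a; b; y₂; y₃)` with `|ι| ≤ 11` (characteristic zero) one gets
a solution `(κ, c', t')` with `|κ| ≤ |ι|`, NON-ZERO weights, the SAME joint identity, SCALAR outer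
blocks (`t'((a,0),(x,0)) ∈ K v₀`, `t'((0,b),(0,x)) ∈ K v₀'` for fixed `v₀, v₀'`), and the reduced
identity `Σ c' (t'((0,b),(y₂,0)) + t'((a,0),(0,y₃)))² = per - 2 Σ c' t'((a,0),(y₂,0)) t'((0,b),(0,y₃))`
(drop zero weights; `NormalForm.normalForm`; in the mirrored case pass to the `y₂ ↔ y₃`-swapped
family; `PureReduction.scalar_block_facts`).  This packages the whole isotropic-kernel reduction:
the (8,8)-column cells need exactly "no such reduced family with `|κ| ≤ 10` resp. `≤ 11`"
(= P1 when `⟨v₀,v₀'⟩ψψ' ≡ 0`, R2 otherwise; both OPEN).  Honest framing: conditional reduction;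
no cell closes; window `27 ≤ sdc(per_4) ≤ 29`, crux, `VP ≠ VNP` untouched.  No definitions, no
named facts. [folklore]
-/

noncomputable section

-- single-conjunct layout: Sub = Summit, duplicated namespace component intended
set_option linter.dupNamespace false

namespace Summit.ValiantsHypothesis.ValiantsHypothesis.Theorems.SymPencilPerFourInnerRankReducedFamily

open Matrix Finset Module
open Summit.ValiantsHypothesis.ValiantsHypothesis.Theorems.SymPencilPerFourInnerRankRows
open Summit.ValiantsHypothesis.ValiantsHypothesis.Theorems.SymPencilPerFourInnerRankTenPairs
open Summit.ValiantsHypothesis.ValiantsHypothesis.Theorems.SymPencilPerFourInnerRankNormalForm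
open Summit.ValiantsHypothesis.ValiantsHypothesis.Theorems.SymPencilPerFourInnerRankPureReduction

universe u v

variable {K : Type u} [Field K]

/-- The reduced identity from scalar outer blocks (case 1 of the normal form). [folklore] -/
theorem reduced_identity_of_scalar [CharZero K] {ι : Type v} [Fintype ι] (c : ι → K)
    (t : ι → (((Fin 4 → K) × (Fin 4 → K)) →ₗ[K] ((Fin 4 → K) × (Fin 4 → K)) →ₗ[K] K))
    (hJ : ∀ a b y₂ y₃ : Fin 4 → K,
      ∑ r, c r * (t r (a, b) (y₂, y₃)) ^ 2 = (Matrix.of ![a, b, y₂, y₃]).permanent)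
    (v₀ v₀' : ι → K) (hv₀ : ∀ (a x : Fin 4 → K), ∃ s : K, (fun r => t r (a, 0) (x, 0)) = s • v₀)
    (hv₀' : ∀ (b x : Fin 4 → K), ∃ s : K, (fun r => t r (0, b) (0, x)) = s • v₀') :
    ∀ a b y₂ y₃ : Fin 4 → K,
      ∑ r, c r * (t r (0, b) (y₂, 0) + t r (a, 0) (0, y₃)) ^ 2 =
        (Matrix.of ![a, b, y₂, y₃]).permanent
          - 2 * ∑ r, c r * t r (a, 0) (y₂, 0) * t r (0, b) (0, y₃) := by
  have hsplit : ∀ (a b y₂ y₃ : Fin 4 → K) r, t r (a, b) (y₂, y₃) =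
      t r (a, 0) (y₂, 0) + t r (0, b) (y₂, 0) + t r (a, 0) (0, y₃) + t r (0, b) (0, y₃) := by
    intro a b y₂ y₃ r
    have hu : ((a, b) : (Fin 4 → K) × (Fin 4 → K)) = (a, 0) + (0, b) := by simp
    have hy : ((y₂, y₃) : (Fin 4 → K) × (Fin 4 → K)) = (y₂, 0) + (0, y₃) := by simp
    rw [hu, hy]; simp only [map_add, LinearMap.add_apply]; ring
  -- the `a ↔ b`, `y₂ ↔ y₃`-swapped design (its `A₂`-block is `B₃`)
  set tS : ι → (((Fin 4 → K) × (Fin 4 → K)) →ₗ[K] ((Fin 4 → K) × (Fin 4 → K)) →ₗ[K] K) :=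
    fun r => ((t r).compl₁₂ (LinearEquiv.prodComm K (Fin 4 → K) (Fin 4 → K)).toLinearMap
      LinearMap.id).compl₂ (LinearEquiv.prodComm K (Fin 4 → K) (Fin 4 → K)).toLinearMap with htS
  have hJS : ∀ a b y₂ y₃ : Fin 4 → K,
      ∑ r, c r * (tS r (a, b) (y₂, y₃)) ^ 2 = (Matrix.of ![a, b, y₂, y₃]).permanent :=
    hJ_yswap c _ (hJ_swap c t hJ)
  have htSap : ∀ r (a b y₂ y₃ : Fin 4 → K), tS r (a, b) (y₂, y₃) = t r (b, a) (y₃, y₂) :=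
    fun r a b y₂ y₃ => by simp [htS]
  obtain ⟨F1, F2, F3⟩ := scalar_block_facts c t hJ v₀ hv₀
  obtain ⟨G1, G2, G3⟩ := scalar_block_facts c tS hJS v₀' (fun b x => by
    obtain ⟨s, hs⟩ := hv₀' b x
    exact ⟨s, by rw [← hs]; funext r; exact htSap r b 0 x 0⟩)
  simp only [htSap] at G1 G2 G3
  intro a b y₂ y₃
  have hT := hJ a b y₂ y₃
  simp_rw [hsplit a b y₂ y₃] at hT
  set α : ι → K := fun r => t r (a, 0) (y₂, 0)
  set β : ι → K := fun r => t r (0, b) (y₂, 0)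
  set γ : ι → K := fun r => t r (a, 0) (0, y₃)
  set δ : ι → K := fun r => t r (0, b) (0, y₃)
  have h1 : ∑ r, c r * α r ^ 2 = 0 := F1 a y₂
  have h2 : ∑ r, c r * δ r ^ 2 = 0 := G1 b y₃
  have h3 : ∑ r, c r * α r * β r = 0 := F3 a y₂ b y₂
  have h4 : ∑ r, c r * α r * γ r = 0 := F2 a y₂ a y₃
  have h5 : ∑ r, c r * δ r * β r = 0 := by
    have := G2 b y₃ b y₂; simpa [δ, β, mul_comm, mul_assoc, mul_left_comm] using this
  have h6 : ∑ r, c r * δ r * γ r = 0 := by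
    have := G3 b y₃ a y₃; simpa [δ, γ, mul_comm, mul_assoc, mul_left_comm] using this
  have e : ∀ r, c r * (β r + γ r) ^ 2 = c r * (α r + β r + γ r + δ r) ^ 2 -
      (c r * α r ^ 2 + c r * δ r ^ 2 + 2 * (c r * α r * β r) + 2 * (c r * α r * γ r) +
        2 * (c r * δ r * β r) + 2 * (c r * δ r * γ r) + 2 * (c r * α r * δ r)) := fun r => by
    ring
  show ∑ r, c r * (β r + γ r) ^ 2 = _ - 2 * ∑ r, c r * α r * δ r
  rw [Finset.sum_congr rfl fun r _ => e r, Finset.sum_sub_distrib, hT]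
  simp only [Finset.sum_add_distrib, ← Finset.mul_sum, h1, h2, h3, h4, h5, h6]
  ring

/-- **The reduced family.**  See the module docstring. [folklore] -/
theorem exists_reduced_family [CharZero K] {ι : Type v} [Fintype ι] [DecidableEq ι]
    (hι : Fintype.card ι ≤ 11) (c : ι → K)
    (t : ι → (((Fin 4 → K) × (Fin 4 → K)) →ₗ[K] ((Fin 4 → K) × (Fin 4 → K)) →ₗ[K] K))
    (hJ : ∀ a b y₂ y₃ : Fin 4 → K,
      ∑ r, c r * (t r (a, b) (y₂, y₃)) ^ 2 = (Matrix.of ![a, b, y₂, y₃]).permanent) :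
    ∃ (κ : Type v) (_ : Fintype κ) (_ : DecidableEq κ) (c' : κ → K)
      (t' : κ → (((Fin 4 → K) × (Fin 4 → K)) →ₗ[K] ((Fin 4 → K) × (Fin 4 → K)) →ₗ[K] K))
      (v₀ v₀' : κ → K),
      Fintype.card κ ≤ Fintype.card ι ∧ (∀ r, c' r ≠ 0) ∧
      (∀ a b y₂ y₃ : Fin 4 → K,
        ∑ r, c' r * (t' r (a, b) (y₂, y₃)) ^ 2 = (Matrix.of ![a, b, y₂, y₃]).permanent) ∧
      (∀ (a x : Fin 4 → K), ∃ s : K, (fun r => t' r (a, 0) (x, 0)) = s • v₀) ∧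
      (∀ (b x : Fin 4 → K), ∃ s : K, (fun r => t' r (0, b) (0, x)) = s • v₀') ∧
      ∀ a b y₂ y₃ : Fin 4 → K,
        ∑ r, c' r * (t' r (0, b) (y₂, 0) + t' r (a, 0) (0, y₃)) ^ 2 =
          (Matrix.of ![a, b, y₂, y₃]).permanent
            - 2 * ∑ r, c' r * t' r (a, 0) (y₂, 0) * t' r (0, b) (0, y₃) := by
  classical
  -- drop the zero weights
  let κ := {r : ι // c r ≠ 0}
  let c₁ : κ → K := fun r => c r.1
  let t₁ : κ → (((Fin 4 → K) × (Fin 4 → K)) →ₗ[K] ((Fin 4 → K) × (Fin 4 → K)) →ₗ[K] K) :=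
    fun r => t r.1
  have hκ : Fintype.card κ ≤ Fintype.card ι := Fintype.card_subtype_le _
  have hc₁ : ∀ r : κ, c₁ r ≠ 0 := fun r => r.2
  have hsum : ∀ f : ι → K, ∑ r : κ, c r.1 * f r.1 = ∑ r, c r * f r := by
    intro f
    have h1 : ∑ r : κ, c r.1 * f r.1 =
        ∑ r ∈ Finset.univ.filter (fun r => c r ≠ 0), c r * f r :=
      (Finset.sum_subtype (Finset.univ.filter (fun r => c r ≠ 0)) (fun r => by simp)
        (fun r => c r * f r)).symm
    rw [h1, Finset.sum_filter]
    refine Finset.sum_congr rfl fun r _ => ?_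
    split_ifs with h
    · rfl
    · rw [not_not.1 h, zero_mul]
  have hJ₁ : ∀ a b y₂ y₃ : Fin 4 → K,
      ∑ r, c₁ r * (t₁ r (a, b) (y₂, y₃)) ^ 2 = (Matrix.of ![a, b, y₂, y₃]).permanent := by
    intro a b y₂ y₃
    rw [← hJ a b y₂ y₃]
    exact hsum fun r => (t r (a, b) (y₂, y₃)) ^ 2
  rcases normalForm (hκ.trans hι) c₁ hc₁ t₁ hJ₁ with ⟨v₀, v₀', hv₀, hv₀'⟩ | ⟨w₀, w₀', hw₀, hw₀'⟩
  · exact ⟨κ, inferInstance, inferInstance, c₁, t₁, v₀, v₀', hκ, hc₁, hJ₁, hv₀, hv₀',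
      reduced_identity_of_scalar c₁ t₁ hJ₁ v₀ v₀' hv₀ hv₀'⟩
  · -- mirrored normal form: pass to the `y₂ ↔ y₃`-swapped family
    let tY : κ → (((Fin 4 → K) × (Fin 4 → K)) →ₗ[K] ((Fin 4 → K) × (Fin 4 → K)) →ₗ[K] K) :=
      fun r => (t₁ r).compl₂ (LinearEquiv.prodComm K (Fin 4 → K) (Fin 4 → K)).toLinearMap
    have hJY : ∀ a b y₂ y₃ : Fin 4 → K,
        ∑ r, c₁ r * (tY r (a, b) (y₂, y₃)) ^ 2 = (Matrix.of ![a, b, y₂, y₃]).permanent :=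
      hJ_yswap c₁ t₁ hJ₁
    have htYap : ∀ r (u : (Fin 4 → K) × (Fin 4 → K)) (y₂ y₃ : Fin 4 → K),
        tY r u (y₂, y₃) = t₁ r u (y₃, y₂) := fun r u y₂ y₃ => by simp [tY]
    have hv : ∀ (a x : Fin 4 → K), ∃ s : K, (fun r => tY r (a, 0) (x, 0)) = s • w₀ := fun a x => by
      obtain ⟨s, hs⟩ := hw₀ a x
      exact ⟨s, by rw [← hs]; funext r; exact htYap r _ x 0⟩
    have hv' : ∀ (b x : Fin 4 → K), ∃ s : K, (fun r => tY r (0, b) (0, x)) = s • w₀' :=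
      fun b x => by
      obtain ⟨s, hs⟩ := hw₀' b x
      exact ⟨s, by rw [← hs]; funext r; exact htYap r _ 0 x⟩
    exact ⟨κ, inferInstance, inferInstance, c₁, tY, w₀, w₀', hκ, hc₁, hJY, hv, hv',
      reduced_identity_of_scalar c₁ tY hJY w₀ w₀' hv hv'⟩

end Summit.ValiantsHypothesis.ValiantsHypothesis.Theorems.SymPencilPerFourInnerRankReducedFamily

end
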